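import Summits.MatrixMultiplication.OmegaCensus.STPPVosperSlackTwoCheckersT

/-!
# ω-census (abelian STPP census): the GENERAL pinned-sumset checker (arbitrary `P` and `Y°` value lists) for the slack-`s` partition laws (kernel tool)

HONEST FRAMING (pub-omega census; verbatim): lottery ticket; floor = certified bounds/negative ranges.
Census STRUCTURE (seat pub-omega-stpp-1 gen 33, 2026-08-28), family (b2).  `caseGDeadT p c z sz P Yo Q tbl`: the table-form checker of
`STPPVosperSlackTwoCheckersT.lean` with the Vosper data replaced by ARBITRARY duplicate-free value lists — `P` (the values of `Aᵢ`, block translation spent)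
and `Yo` (the values of `Y° = ⋃_{k≠i}(C_k − B_k)`, global `C`-offset spent) — so that ONE checker serves every structured cell of a slack-`s` dual chain
(HOME `pub-omega-stpp-1-g33/FIFTH-LEAF.md`, the fifth ℤ₆₁ leaf `{(2,2,2),(3,3,3)²}`, slack 4): Vosper cells (`P = [0,a)`, `Yo = [a−1, a−1+L)`),
Hamidoune–Rødseth cells (`P = [0,a] ∖ {h′}`, `Yo = (a + [0,L]) ∖ {a+k}`), and zoo cells (explicit lists).  The cover `SY = −P + Y°` is computed as the mask
`⋁_{x∈P} rot (maskOf Yo) (p − x)` and must have exactly `sz` members (else the row is vacuous: the cell fixes `#SY`); then all `c` translates of the pattern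
`P + Q` are tiled from the cover `SY` (`tilesAll`), and the leaf `caseGLeafT` looks the pairs `(Yo, Zo)` up in the dead table (`Zo` = every `z`-sublist of
the candidate mask `⋂_{q∈Q}(Tfree + q)`).  Control flow: `mem_of_caseGLeafT`, `caseGLeafT_of_caseGDeadT`.  Nothing here is progress on `ω`.

References: H. Cohn, R. Kleinberg, B. Szegedy, C. Umans, FOCS 2005 (arXiv:math/0511460), Def. 5.1; A. G. Vosper, J. London Math. Soc. 31 (1956);
Y. O. Hamidoune, Ø. J. Rødseth, Acta Arith. 92 (2000).
-/

namespace Summit.MatrixMultiplication.OmegaCensus.CubeNB.S2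

open Summit.MatrixMultiplication.OmegaCensus.CubeNB.Bits

/-- **General leaf**: at a tiling with cover `cov ⊇ SY`, every `z`-sublist `Zo` of the members of `Zc = ⋂_{q ∈ Q}((univ ∖ cov) + q)`, paired with the
given `Yo`, must be in the dead table. [cite: CohnKleinbergSzegedyUmans2005, Def. 5.1] -/
def caseGLeafT (p z : ℕ) (Q Yo : List ℕ) (tbl : List (List ℕ × List ℕ)) (_R : List ℕ) (cov : ℕ) : Bool :=
  let tfree := fullMask p ^^^ cov
  let zc := Q.foldl (fun m q => m &&& rot p tfree q) (fullMask p)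
  !(Nat.ble z (popc (List.range p) zc)) || ((members (List.range p) zc).sublistsLen z).all fun Zo => decide ((Yo, Zo) ∈ tbl)

/-- **The general pinned-sumset checker**: pattern `P + Q` duplicate-free, cover `SY = −P + Yo` (as a mask) of exactly `sz` members, all `c` translates
tiled from `SY`, then the leaf. [cite: CohnKleinbergSzegedyUmans2005, Def. 5.1] -/
def caseGDeadT (p c z sz : ℕ) (P Yo Q : List ℕ) (tbl : List (List ℕ × List ℕ)) : Bool :=
  let patt := pattPQ p P Q
  !(decide patt.Nodup) ||
    (let syM := P.foldl (fun m x => m ||| rot p (maskOf Yo) (p - x)) 0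
     !(Nat.beq (popc (List.range p) syM) sz) || tilesAll (caseGLeafT p z Q Yo tbl) c (transMasks p patt) [] syM)

/-- **The general leaf is exhaustive.** [cite: CohnKleinbergSzegedyUmans2005, Def. 5.1] -/
theorem mem_of_caseGLeafT {p z : ℕ} {Q Yo : List ℕ} {tbl : List (List ℕ × List ℕ)} {R : List ℕ} {cov : ℕ}
    (h : caseGLeafT p z Q Yo tbl R cov = true) (Zo : List ℕ)
    (hZo : Zo ∈ (members (List.range p) (Q.foldl (fun m q => m &&& rot p (fullMask p ^^^ cov) q) (fullMask p))).sublistsLen z) :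
    (Yo, Zo) ∈ tbl := by
  unfold caseGLeafT at h
  simp only [Bool.or_eq_true, Bool.not_eq_true', List.all_eq_true, decide_eq_true_eq] at h
  rcases h with h | h
  · exfalso
    have hlen := List.mem_sublistsLen.1 hZo
    have hle := hlen.1.length_le
    rw [hlen.2, ← popc_eq_length_members] at hle
    rw [Nat.ble_eq_true_of_le hle] at h
    exact Bool.noConfusion h
  · exact h Zo hZo

/-- **The general checker is exhaustive**: if it returns `true`, the pattern is duplicate-free and the cover mask has `sz` members, then at every
sequentially admissible choice of `c` translates from the cover the leaf holds. [cite: CohnKleinbergSzegedyUmans2005, Def. 5.1] -/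
theorem caseGLeafT_of_caseGDeadT {p c z sz : ℕ} {P Yo Q : List ℕ} {tbl : List (List ℕ × List ℕ)} (h : caseGDeadT p c z sz P Yo Q tbl = true)
    (hpatt : (pattPQ p P Q).Nodup) (hsz : popc (List.range p) (P.foldl (fun m x => m ||| rot p (maskOf Yo) (p - x)) 0) = sz)
    (rs : List (ℕ × ℕ)) (hsub : rs.Sublist (transMasks p (pattPQ p P Q))) (hlen : rs.length = c)
    (hadm : admissible (P.foldl (fun m x => m ||| rot p (maskOf Yo) (p - x)) 0) rs = true) :
    caseGLeafT p z Q Yo tbl (rs.map Prod.fst)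
      (rs.foldl (fun cv x => cv ||| x.2) (P.foldl (fun m x => m ||| rot p (maskOf Yo) (p - x)) 0)) = true := by
  unfold caseGDeadT at h
  simp only [hpatt, decide_true, Bool.not_true, Bool.false_or, hsz, Nat.beq_refl] at h
  by_contra hleaf
  rw [Bool.not_eq_true] at hleaf
  have key := tilesAll_complete (caseGLeafT p z Q Yo tbl) _ rs [] _ hsub hadm (by simpa using hleaf)
  rw [hlen, h] at key
  exact Bool.noConfusion key

end Summit.MatrixMultiplication.OmegaCensus.CubeNB.S2
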